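import Literature.AlgebraicGeometry.Modules.DeterminantCocycleExact
import Literature.AlgebraicGeometry.Modules.PullbackFrame
import Literature.AlgebraicGeometry.KTheory.GrothendieckGroup
import HarnessLib

/-!
# The determinant homomorphism `det : K₀(X) → Ȟ¹(X, 𝒪_X^×)`

The determinant of vector bundles, `E ↦ det E = Λ^{rk E} E`, is additive on short exact sequences and
so descends to a homomorphism from the Grothendieck group `K₀(X)` of vector bundles
(`KTheory/GrothendieckGroup.lean`, Fulton's `K⁰X`) to the Picard group, commuting with pull-back
(Hartshorne II Ex. 6.11 "`det : K(X) → Pic X`"; SGA 6 / Fulton §15.1). Here the Picard group is taken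
in its Čech form `CechPic X = Ȟ¹(X, 𝒪_X^×)` on point-indexed covers (`Modules/UnitCocycle.lean`) and
`det` is the cocycle-valued determinant class `detClass` (`Modules/DeterminantCocycle.lean`,
`Modules/DeterminantCocycleExact.lean`), which avoids exterior powers of sheaves of modules (absent
from Mathlib at this pin):

* `KZero.det : KZero X →+ Additive (CechPic X)`, `KZero.det_of : det [E] = [det E]`;
* `KZero.det_map : det (f^* y) = f^* (det y)` (`Modules/PullbackFrame.lean`, `detClass_pullback`).

Everything is proved; no named facts.

## References

* R. Hartshorne, *Algebraic Geometry*, GTM 52 (1977), II Ex. 6.11, II Ex. 6.8. [Hartshorne1977]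
* W. Fulton, *Intersection theory*, 2nd ed. (1998), §15.1. [Fulton1998]
-/

noncomputable section

open CategoryTheory AlgebraicGeometry

namespace Literature.AlgebraicGeometry.KTheory

open Literature.AlgebraicGeometry.Motives Literature.AlgebraicGeometry.Modules

universe u

variable {X Y : Scheme.{u}}

namespace KZero

/-- **The determinant homomorphism `det : K₀(X) → Ȟ¹(X, 𝒪_X^×)`**, `[E] ↦ [det E]` (Hartshorne II
Ex. 6.11), well defined by the additivity of the determinant class on short exact sequences of vector
bundles (`detClass_mul_of_shortExact`). [cite: Hartshorne1977, II Ex. 6.11] -/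
def det : KZero X →+ Additive (CechPic X) :=
  lift (fun _ hE => Additive.ofMul (detClass hE)) fun _ hS h₁ h₂ h₃ => by
    rw [← ofMul_mul, ← detClass_mul_of_shortExact hS h₁ h₂ h₃]

/-- `det [E] = [det E]`. [folklore] -/
@[simp]
theorem det_of (E : X.Modules) (hE : IsFiniteLocallyFree E) :
    det (of E hE) = Additive.ofMul (detClass hE) :=
  lift_of _ _ E hE

/-- **`det` commutes with pull-back**: `det (f^* y) = f^*(det y)` for `f : X ⟶ Y` and `y ∈ K₀(Y)`
(Hartshorne II Ex. 6.8: `f^*` on `K` and on `Pic`). [cite: Hartshorne1977, II Ex. 6.8] -/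
theorem det_map (f : X ⟶ Y) (y : KZero Y) :
    det (map f y) = Additive.ofMul (CechPic.pullback f (Additive.toMul (det y))) := by
  induction y using KZero.induction_on with
  | zero => rw [map_zero, map_zero, map_zero, toMul_zero, map_one, ofMul_one]
  | of E hE => rw [map_of, det_of, det_of, toMul_ofMul, detClass_pullback]
  | neg x hx => rw [map_neg, map_neg, map_neg, hx, toMul_neg, map_inv, ofMul_inv]
  | add x y hx hy => rw [map_add, map_add, map_add, hx, hy, toMul_add, map_mul, ofMul_mul]

end KZero

end Literature.AlgebraicGeometry.KTheory

end
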